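import Mathlib
import Summits.Ventures.PercRepro2.DisjointInjection

/-!
# The pairing inequality on a down-set (blind cell PercRepro2, p3 g22, 2026-08-28)

The abstract form of STEP 4 of `proofs/P3-CPNC.md` §19h/§19l: on a product «orbit × down-set»
— an outside index set `s` with an involution `σ` (the flip of the outside colouring) and a
down-set `D` of subsets of a finite set (the fixed blocks and the moved super-components of a
projection class) — two non-negative functions `Y`, `W` with `Y ω T ≤ W (σ ω) T'` whenever
`T` and `T'` are disjoint satisfy `∑_{ω ∈ s} ∑_{T ∈ D} (Y ω T − W ω T) ≤ 0`
(`sum_sub_nonpos_of_downset_pairing`).  Proof: the disjointness injection `φ` of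
`DisjointInjection` and the reindexing `ω ↦ σ ω`, then `φ`'s injectivity and `W ≥ 0`.
Own work, one seat.
-/

namespace Summit.Ventures.PercRepro2

namespace DownsetInjection

open Finset

variable {ι : Type*} [DecidableEq ι] {Ω : Type*}

/-- **The pairing inequality.** `Y ω T ≤ W (σ ω) T'` for disjoint `T, T' ∈ D` (a down-set),
`W ≥ 0`, `σ` an involution of `s` ⟹ `∑_{ω ∈ s} ∑_{T ∈ D} (Y ω T − W ω T) ≤ 0`. -/
theorem sum_sub_nonpos_of_downset_pairing (U : Finset ι) (D : Finset (Finset ι))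
    (hDU : ∀ T ∈ D, T ⊆ U) (hD : ∀ T ∈ D, ∀ T', T' ⊆ T → T' ∈ D) (hne : D.Nonempty)
    (s : Finset Ω) (σ : Ω → Ω) (hσ : ∀ ω ∈ s, σ ω ∈ s) (hσinv : ∀ ω ∈ s, σ (σ ω) = ω)
    (Y W : Ω → Finset ι → ℤ) (hW : ∀ ω T, 0 ≤ W ω T)
    (hYW : ∀ ω ∈ s, ∀ T ∈ D, ∀ T' ∈ D, Disjoint T T' → Y ω T ≤ W (σ ω) T') :
    ∑ ω ∈ s, ∑ T ∈ D, (Y ω T - W ω T) ≤ 0 := by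
  obtain ⟨φ, hφ, hφinj⟩ := exists_disjoint_injOn_of_downset U D hDU hD hne
  -- step 1: `Y ω T ≤ W (σ ω) (φ T)`
  have h1 : ∑ ω ∈ s, ∑ T ∈ D, Y ω T ≤ ∑ ω ∈ s, ∑ T ∈ D, W (σ ω) (φ T) :=
    Finset.sum_le_sum fun ω hω => Finset.sum_le_sum fun T hT =>
      hYW ω hω T hT (φ T) (hφ T hT).1 (hφ T hT).2
  -- step 2: reindex the outside by the involution
  have h2 : ∑ ω ∈ s, ∑ T ∈ D, W (σ ω) (φ T) = ∑ ω ∈ s, ∑ T ∈ D, W ω (φ T) :=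
    Finset.sum_nbij' σ σ (fun ω hω => hσ ω hω) (fun ω hω => hσ ω hω)
      (fun ω hω => hσinv ω hω) (fun ω hω => hσinv ω hω) (fun ω _ => rfl)
  -- step 3: `φ` is injective on `D` and `W ≥ 0`
  have h3 : ∀ ω, ∑ T ∈ D, W ω (φ T) ≤ ∑ T ∈ D, W ω T := by
    intro ω
    rw [← Finset.sum_image (f := fun T => W ω T) (g := φ) (s := D) hφinj]
    refine Finset.sum_le_sum_of_subset_of_nonneg ?_ fun T _ _ => hW ω T
    intro T hT
    obtain ⟨T₀, hT₀, rfl⟩ := Finset.mem_image.1 hT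
    exact (hφ T₀ hT₀).1
  have h4 : ∑ ω ∈ s, ∑ T ∈ D, W ω (φ T) ≤ ∑ ω ∈ s, ∑ T ∈ D, W ω T :=
    Finset.sum_le_sum fun ω _ => h3 ω
  have : ∑ ω ∈ s, ∑ T ∈ D, (Y ω T - W ω T)
      = ∑ ω ∈ s, ∑ T ∈ D, Y ω T - ∑ ω ∈ s, ∑ T ∈ D, W ω T := by
    simp only [Finset.sum_sub_distrib]
  rw [this]
  linarith

end DownsetInjection

end Summit.Ventures.PercRepro2
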